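import Literature.NumberTheory.LFunctions.ConreyIwaniec2002AFEDefs
import Mathlib.Analysis.SpecialFunctions.SmoothTransition
import HarnessLib

/-!
# Conrey–Iwaniec (2002), §§7–8: the weights of the divided difference of `A(s)` (definitions)

B. Conrey, H. Iwaniec, *Spacing of zeros of Hecke L-functions and the class number problem*,
Acta Arith. 103 (2002), §7 (7.21)–(7.23) and §8 (8.5)–(8.9) [held text
`paper:arxiv-math_0111012`, p0017 L150–175, p0018 L120–170].

For `s = ½ + it`, `s′ = ½ + it′` (`t ≠ t′`) the divided difference of the first sum of the
approximate functional equation (7.12), `A(s) = Σ_n λ(n) n^{−s} V_s(n/Q)`, is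
  `(A(s) − A(s′))/(s − s′) = Σ_n λ(n) n^{−1/2} · n^{−it} · Ω_{t,t′}(log n)`,
because `n^{−s′} = n^{−s} e^{i(t−t′) log n}`, with the WEIGHT (in the variable `u = log n`)
  `Ω_{t,t′}(u) = (V_s(e^u/Q) − V_{s′}(e^u/Q))/(s − s′) + V_{s′}(e^u/Q) · (1 − e^{(s−s′)u})/(s − s′)`
((7.21)–(7.23): CI write `ℓ`-type divided differences; §8 (8.5) estimates `Σ_s |·|²` range by
range). §8 feeds these sums to the discrete mean-value theorems of §5 (Lemma 5.3 / Proposition 5.4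
with point-dependent smooth weights, the tree's `WeightedMeanValue.weighted_discreteMeanValue(_integral)`),
whose weights are functions of `log n`. This file fixes the vocabulary (no analysis):
* `afeVlog q w u = V_w(e^u/Q)` — the cut-off `V` of (7.14) in the logarithmic variable;
* `afeOmega q t t′ u = Ω_{t,t′}(u)` — the weight above;
* `tailCutoff c₀ q T y = c₀ η(y/T − 1)(1 + y/(qT))^{−4}` — the explicit cut-off of the class (6.38)
  used for the range `n ≫ T` in (8.7) (`η = Real.smoothTransition`; it is the function of
  `ConreyIwaniec2002.exists_tailCutoff`, given a name),
and records the algebra `(s − s′)·Ω = V_s − V_{s′}e^{(s−s′)u}` (`sub_mul_afeOmega`) and the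
termwise identity behind the display above (`afeVlog_mul_cpow_sub`).

«The programme SEARCHES and TYPES; no claim about Landau–Siegel zeros until a kernel theorem says so.»

## References
* [ConreyIwaniec2002] B. Conrey, H. Iwaniec, Acta Arith. 103 (2002) 259–312, arXiv:math/0111012:
  §7 (7.12), (7.14), (7.21)–(7.23); §8 (8.5)–(8.9); Corollary 6.2 (6.38).
-/

noncomputable section

open scoped NumberField
open Complex

namespace Literature.NumberTheory.LFunctions

namespace ConreyIwaniec2002

/-- **`V_w(e^u/Q)`** — the cut-off `V` of (7.14) (the tree's `afeV`) as a function of the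
logarithmic variable `u = log n` (`Q = √q/2π` the tree's `condQ`), the form in which §8 feeds it to
the weighted mean-value theorems of §5. [cite: ConreyIwaniec2002, Proposition 7.1 (7.14), §8 (8.5)] -/
def afeVlog (q : ℕ) (w : ℂ) (u : ℝ) : ℂ :=
  afeV w (Real.exp u / condQ q)

/-- **The weight `Ω_{t,t′}(u)` of the divided difference of `A(s)`** (`s = ½+it`, `s′ = ½+it′`,
`t ≠ t′`): `Ω = (V_s − V_{s′})/(s − s′) + V_{s′}·(1 − e^{(s−s′)u})/(s − s′)` evaluated at
`y = e^u/Q`, so that `(A(s) − A(s′))/(s − s′) = Σ_n λ(n)n^{−1/2}n^{−it}Ω_{t,t′}(log n)`.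
[cite: ConreyIwaniec2002, §7 (7.21)–(7.23), §8 (8.5)] -/
def afeOmega (q : ℕ) (t t' u : ℝ) : ℂ :=
  (afeVlog q (1 / 2 + t * I) u - afeVlog q (1 / 2 + t' * I) u) / ((t : ℂ) * I - t' * I) +
    afeVlog q (1 / 2 + t' * I) u *
      ((1 - Complex.exp (((t : ℂ) * I - t' * I) * u)) / ((t : ℂ) * I - t' * I))

/-- **The tail cut-off `a(y) = c₀·η(y/T − 1)·(1 + y/(qT))^{−4}`** of the class (6.38) for the
range `n ≫ T` of (8.7) (`η` = `Real.smoothTransition`: `a = 0` on `y ≤ T`,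
`a = c₀(1 + y/(qT))^{−4}` on `y ≥ 2T`); for an absolute `c₀ > 0` it lies in
`IsCutoff · T′ (qT′)` for every `T′ ∈ [T/2, 2T]` (`ConreyIwaniec2002.exists_tailCutoff`).
[cite: ConreyIwaniec2002, Corollary 6.2 (6.38), §8 (8.7)] -/
def tailCutoff (c₀ q T y : ℝ) : ℝ :=
  c₀ * (Real.smoothTransition (y / T - 1) * ((1 + y / (q * T))⁻¹) ^ 4)

/-! ### Small API -/

/-- Unfolding `afeVlog`. [cite: ConreyIwaniec2002, Proposition 7.1 (7.14)] -/
theorem afeVlog_apply (q : ℕ) (w : ℂ) (u : ℝ) :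
    afeVlog q w u = afeV w (Real.exp u / condQ q) := rfl

/-- `afeVlog q w (log n) = V_w(n/Q)` for `n ≥ 1`. [cite: ConreyIwaniec2002, Proposition 7.1 (7.14)] -/
theorem afeVlog_log {q : ℕ} (w : ℂ) {n : ℕ} (hn : n ≠ 0) :
    afeVlog q w (Real.log n) = afeV w (n / condQ q) := by
  rw [afeVlog, Real.exp_log (by exact_mod_cast Nat.pos_of_ne_zero hn)]

/-- Unfolding `tailCutoff`. [cite: ConreyIwaniec2002, Corollary 6.2 (6.38)] -/
theorem tailCutoff_apply (c₀ q T y : ℝ) :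
    tailCutoff c₀ q T y = c₀ * (Real.smoothTransition (y / T - 1) * ((1 + y / (q * T))⁻¹) ^ 4) :=
  rfl

/-- The tail cut-off vanishes on `y ≤ T` (`T > 0`). [cite: ConreyIwaniec2002, §8 (8.7)] -/
theorem tailCutoff_of_le {c₀ q T y : ℝ} (hT : 0 < T) (hy : y ≤ T) : tailCutoff c₀ q T y = 0 := by
  rw [tailCutoff, Real.smoothTransition.zero_of_nonpos, zero_mul, mul_zero]
  rw [sub_nonpos, div_le_one hT]
  exact hy

/-- The tail cut-off equals `c₀(1 + y/(qT))^{−4}` on `y ≥ 2T` (`T > 0`).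
[cite: ConreyIwaniec2002, §8 (8.7)] -/
theorem tailCutoff_of_two_mul_le {c₀ q T y : ℝ} (hT : 0 < T) (hy : 2 * T ≤ y) :
    tailCutoff c₀ q T y = c₀ * ((1 + y / (q * T))⁻¹) ^ 4 := by
  rw [tailCutoff, Real.smoothTransition.one_of_one_le, one_mul]
  rw [le_sub_iff_add_le, le_div_iff₀ hT]
  linarith

/-- `0 ≤ a(y) ≤ c₀(1 + y/(qT))^{−4}` for `c₀ ≥ 0`, `1 + y/(qT) > 0`.
[cite: ConreyIwaniec2002, §8 (8.7)] -/
theorem tailCutoff_nonneg_le {c₀ q T y : ℝ} (hc : 0 ≤ c₀) (hy : 0 < 1 + y / (q * T)) :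
    0 ≤ tailCutoff c₀ q T y ∧ tailCutoff c₀ q T y ≤ c₀ * ((1 + y / (q * T))⁻¹) ^ 4 := by
  have h0 := Real.smoothTransition.nonneg (y / T - 1)
  have h1 := Real.smoothTransition.le_one (y / T - 1)
  have hr : 0 ≤ ((1 + y / (q * T))⁻¹) ^ 4 := pow_nonneg (inv_nonneg.mpr hy.le) 4
  refine ⟨by unfold tailCutoff; positivity, ?_⟩
  unfold tailCutoff
  calc c₀ * (Real.smoothTransition (y / T - 1) * ((1 + y / (q * T))⁻¹) ^ 4)
      ≤ c₀ * (1 * ((1 + y / (q * T))⁻¹) ^ 4) := by gcongr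
    _ = c₀ * ((1 + y / (q * T))⁻¹) ^ 4 := by rw [one_mul]

/-- **`(s − s′)·Ω_{t,t′}(u) = V_s(e^u/Q) − V_{s′}(e^u/Q)·e^{(s−s′)u}`** for `t ≠ t′`.
[cite: ConreyIwaniec2002, §7 (7.21)–(7.23)] -/
theorem sub_mul_afeOmega (q : ℕ) {t t' : ℝ} (h : t ≠ t') (u : ℝ) :
    ((t : ℂ) * I - t' * I) * afeOmega q t t' u =
      afeVlog q (1 / 2 + t * I) u -
        afeVlog q (1 / 2 + t' * I) u * Complex.exp (((t : ℂ) * I - t' * I) * u) := by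
  have hne : ((t : ℂ) * I - t' * I) ≠ 0 := by
    rw [← sub_mul]
    refine mul_ne_zero ?_ I_ne_zero
    rw [sub_ne_zero]
    exact fun h' => h (by exact_mod_cast h')
  have hne2 : (t : ℂ) - t' ≠ 0 := by
    rw [sub_ne_zero]
    exact fun h' => h (by exact_mod_cast h')
  unfold afeOmega
  rw [← sub_mul]
  field_simp
  ring

/-- **The termwise identity**: for `n ≥ 1` and `t ≠ t′`,
`V_s(n/Q)·n^{−(½+it)} − V_{s′}(n/Q)·n^{−(½+it′)} = (s − s′)·n^{−1/2}·n^{−it}·Ω_{t,t′}(log n)`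
(`n^{−it′} = n^{−it}e^{i(t−t′)log n}`). [cite: ConreyIwaniec2002, §7 (7.21)–(7.23), §8 (8.5)] -/
theorem afeVlog_mul_cpow_sub (q : ℕ) {t t' : ℝ} (h : t ≠ t') {n : ℕ} (hn : n ≠ 0) :
    afeV (1 / 2 + t * I) (n / condQ q) * (n : ℂ) ^ (-(1 / 2 + (t : ℂ) * I)) -
        afeV (1 / 2 + t' * I) (n / condQ q) * (n : ℂ) ^ (-(1 / 2 + (t' : ℂ) * I)) =
      ((t : ℂ) * I - t' * I) * afeOmega q t t' (Real.log n) *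
        ((n : ℂ) ^ (-(1 / 2 : ℂ)) * (n : ℂ) ^ (-((t : ℂ) * I))) := by
  rw [sub_mul_afeOmega q h, afeVlog_log _ hn, afeVlog_log _ hn]
  have hn' : (n : ℂ) ≠ 0 := by exact_mod_cast hn
  have hlog : Complex.log (n : ℂ) = (Real.log n : ℂ) := Complex.natCast_log.symm
  -- `n^{−(½+it)} = n^{−1/2} n^{−it}` and `n^{−it′} = n^{−it} e^{(it − it′) log n}`
  have e1 : (n : ℂ) ^ (-(1 / 2 + (t : ℂ) * I)) = (n : ℂ) ^ (-(1 / 2 : ℂ)) * (n : ℂ) ^ (-((t : ℂ) * I)) := by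
    rw [neg_add, Complex.cpow_add _ _ hn']
  have e2 : (n : ℂ) ^ (-(1 / 2 + (t' : ℂ) * I)) =
      (n : ℂ) ^ (-(1 / 2 : ℂ)) * (n : ℂ) ^ (-((t : ℂ) * I)) *
        Complex.exp (((t : ℂ) * I - t' * I) * (Real.log n : ℂ)) := by
    rw [show (-(1 / 2 + (t' : ℂ) * I)) = -(1 / 2 : ℂ) + (-((t : ℂ) * I) + ((t : ℂ) * I - t' * I)) by ring,
      Complex.cpow_add _ _ hn', Complex.cpow_add _ _ hn', Complex.cpow_def_of_ne_zero hn'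
        ((t : ℂ) * I - t' * I), hlog, mul_comm ((Real.log n : ℝ) : ℂ)]
    ring
  rw [e1, e2]
  ring

end ConreyIwaniec2002

end Literature.NumberTheory.LFunctions
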